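import Summits.BirchSwinnertonDyer.Rank1Residual.Additive.CyclotomicTowerLocalTorsionDescent
import HarnessLib

/-!
# The generic trace of cc-typer-6's tower is TRANSITIVE and Galois-EQUIVARIANT; `E^ε(K_{n,v})` is
# monotone in the layer and `Γ_E`-stable; the trivial bound
# `[K_{n+1,v} : K_{n,v}]·E(K_{n+1,v}) ⊆ E^{(−1)^{n+1}}(K_{n+1,v}) + E(K_{n,v})` — cell `b2b-bsdres`,
# CLASS-CLOSURE lane, class O10 — x1b GEN 33, class lead; file 14 of the local series (the algebra
# under Kobayashi's Prop. 8.12 ii) generation half `E(K_{n,v}) = E⁺(K_{n,v}) + E⁻(K_{n,v})`, part 1)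

HONEST FRAMING (cell `b2b-bsdres`, run/shared/lean/b2b/bsd-rank1-residual/, verbatim in every
file): the goal of the cell is to DELETE the COMBINATION-SHAPED residual classes of the
Birch–Swinnerton-Dyer formula for ALL analytic-rank `≤ 1` elliptic curves over `ℚ` — "full BSD
formula for every rank `≤ 1` curve in class `C`" assembled STRICTLY from published theorems — so
that the rank-`≤ 1` remainder becomes exactly the CONSTRUCTION-SHAPED classes, which are TYPED
(missing-input `Prop`s), NOT attempted. This is not "finishing BSD". CLASS-CLOSURE lane: prove
what is provable now; shrink each hard class to its core with data; no claim beyond stated classes;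
research routes on CONSTRUCTION-SHAPED X12 / O10; census / instrument output = EVIDENCE / conjecture
items, NEVER a Literature fact; `RESIDUAL-MAP.md` marks change only by signed lines. THIS FILE:
TOOL THEOREMS ONLY over cc-typer-6's vocabulary (`localPairTraceOfEmb`, `towerSignedLocalPointsOfEmb`,
`Additive/CyclotomicTowerSignedLocal.lean`) for a GENERIC antitone tower of normal finite-index
subgroups — no definition, no named Literature fact, no Summits-side fact `def`, no `sorry`, axioms
standard; nothing is booked; no label / mark / count / sub-cell moves; O10 stays OPEN /
CONSTRUCTION-SHAPED; nothing about `BSD(W, p)` of any pair is claimed.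

## What is proved (tower `U : ℕ → Subgroup Γ_K`, `E(K_{n,v}) = localFixedPointsOfEmb ι W (U n)`,
## `E(K_{−1,v}) = localFixedPointsOfEmb ι W ⊤`, `Tr_{n/m} = localPairTraceOfEmb ι W (U m) (U n)`)

* §1 **Trace transitivity** `localPairTraceOfEmb_trans`: for `H₃ ≤ H₂ ≤ H₁` and `P ∈ E(L₃,w)`,
  `Tr_{L₃/L₁} P = Tr_{L₂/L₁}(Tr_{L₃/L₂} P)` (`Γ/H₃ ≃ Γ/H₂ × H₂/H₃`, Mathlib
  `Subgroup.quotientEquivProdOfLE`); re-indexing lemma `localPairTraceOfEmb_eq_sum_of_bijective`;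
  **Galois equivariance** `smul_localPairTraceOfEmb_of_normal`: `g • Tr P = Tr (g • P)` for normal
  `H₁, H₂` (conjugation permutes the cosets).
* §2 For an ANTITONE tower of NORMAL finite-index subgroups: `towerSignedLocalPointsOfEmb_mono`
  (`E^ε(K_{m,v}) ≤ E^ε(K_{n,v})` for `m ≤ n`: the traces of a lower point are multiples of lower
  traces — "`C_ss(m_{n−2}) ⊆ C_ss(m_n)`" in the proof of Prop. 8.12); `smul_mem_towerSignedLocalPointsOfEmb`
  (`E^ε(K_{n,v})` is `Γ_E`-stable, so the conjugates `c_n^σ` of Prop. 8.11 / 8.12 i) stay inside);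
  **the trivial bound** `index_smul_mem_sup`: `[K_{n+1,v} : K_{n,v}]·P ∈ E^{(−1)^{n+1}}(K_{n+1,v}) ⊔
  E(K_{n,v})` for `P ∈ E(K_{n+1,v})` (`d·P − Tr_{n+1/n} P` has ALL lower traces zero,
  `mem_towerSignedLocalPointsOfEmb_of_trace_eq_zero`) — generation modulo the previous layer holds
  UP TO the index `p`; Prop. 8.12 ii) is the removal of this `p` (part 2,
  `CyclotomicTowerSignedGenerationReduction.lean`, and the Honda-theory files of the series).

References: [Kobayashi2003] S. Kobayashi, Invent. Math. 152 (2003), §2 p. 4 (`E^±(K_{n,v})`,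
`Tr_{n/m+1}`), Prop. 8.11, Prop. 8.12 and its proof (pp. 17–18); [SerreGaloisCohomology1997]
I.§2.4, II.§1.1 (corestriction / traces, local subgroups).
-/

noncomputable section

open scoped Classical

universe u

namespace Summit.BirchSwinnertonDyer.Rank1Residual.Additive

open Literature.NumberTheory.EllipticCurves Literature.NumberTheory.GaloisRepresentations
  Literature.NumberTheory.EllipticCurves.Kobayashi2003

/-! ## §1 Trace transitivity and Galois equivariance of the generic trace -/

section Trans

variable {K : Type u} [Field K] {E : Type u} [Field E] [Algebra K E]
  (ι : AlgebraicClosure K →ₐ[K] AlgebraicClosure E) (W : WeierstrassCurve K)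

/-- **Re-indexing the trace.** For `P ∈ E(L₂,w)` and ANY family `g : X → (H₁)_E` whose classes
`g x · ((H₂)_E ∩ (H₁)_E)` enumerate the quotient bijectively, `Tr_{L₂/L₁} P = ∑ₓ g x • P`
(the summand `q.out • P` only depends on the coset `q`, `out_smul_eq_of_mem_localFixedPointsOfEmb`).
[cite: Kobayashi2003, §2 p. 4 (the trace maps)] -/
theorem localPairTraceOfEmb_eq_sum_of_bijective (H₁ H₂ : Subgroup (Field.absoluteGaloisGroup K))
    [H₂.FiniteIndex] {P : localPoints W E} (hP : P ∈ localFixedPointsOfEmb ι W H₂)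
    {X : Type*} [Fintype X] (g : X → localSubgroupOfEmb H₁ ι)
    (hg : Function.Bijective fun x =>
      (QuotientGroup.mk (g x) : localSubgroupOfEmb H₁ ι ⧸
        (localSubgroupOfEmb H₂ ι).subgroupOf (localSubgroupOfEmb H₁ ι))) :
    localPairTraceOfEmb ι W H₁ H₂ P = ∑ x, ((g x : localSubgroupOfEmb H₁ ι) :
      Field.absoluteGaloisGroup E) • P := by
  haveI : Fintype (localSubgroupOfEmb H₁ ι ⧸
      (localSubgroupOfEmb H₂ ι).subgroupOf (localSubgroupOfEmb H₁ ι)) := Fintype.ofFinite _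
  rw [localPairTraceOfEmb_apply]
  rw [← hg.sum_comp (fun q : localSubgroupOfEmb H₁ ι ⧸
      (localSubgroupOfEmb H₂ ι).subgroupOf (localSubgroupOfEmb H₁ ι) =>
        ((q.out : localSubgroupOfEmb H₁ ι) : Field.absoluteGaloisGroup E) • P)]
  exact Finset.sum_congr rfl fun x _ => out_smul_eq_of_mem_localFixedPointsOfEmb ι W hP (g x)

/-- **Transitivity of the trace**: for `H₃ ≤ H₂ ≤ H₁` (fields `L₁ ⊆ L₂ ⊆ L₃`), `H₂, H₃` of finite
index, and `P ∈ E(L₃,w)`: `Tr_{L₃/L₁} P = Tr_{L₂/L₁} (Tr_{L₃/L₂} P)` — the cosets of `(H₃)_E` in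
`(H₁)_E` are the products `q̃ r̃` of coset representatives of `(H₂)_E` in `(H₁)_E` and of `(H₃)_E` in
`(H₂)_E` (Mathlib `Subgroup.quotientEquivProdOfLE`). For Kobayashi's tower:
`Tr_{n/m} = Tr_{k/m} ∘ Tr_{n/k}` (`m ≤ k ≤ n`). [cite: Kobayashi2003, §2 p. 4 (the trace maps Tr_{n/m+1})]
[cite: SerreGaloisCohomology1997, I.§2.4] -/
theorem localPairTraceOfEmb_trans {H₁ H₂ H₃ : Subgroup (Field.absoluteGaloisGroup K)}
    [H₂.FiniteIndex] [H₃.FiniteIndex] (h₁₂ : H₂ ≤ H₁) (h₂₃ : H₃ ≤ H₂) {P : localPoints W E}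
    (hP : P ∈ localFixedPointsOfEmb ι W H₃) :
    localPairTraceOfEmb ι W H₁ H₃ P =
      localPairTraceOfEmb ι W H₁ H₂ (localPairTraceOfEmb ι W H₂ H₃ P) := by
  -- notation: `A = (H₁)_E ⊇ B = (H₂)_E ⊇ C = (H₃)_E`; `t = B ∩ A ≤ A`, `s = C ∩ A ≤ A`
  set A := localSubgroupOfEmb H₁ ι with hA
  set B := localSubgroupOfEmb H₂ ι with hB
  set C := localSubgroupOfEmb H₃ ι with hC
  have hBA : B ≤ A := Subgroup.comap_mono h₁₂
  have hCB : C ≤ B := Subgroup.comap_mono h₂₃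
  have hst : C.subgroupOf A ≤ B.subgroupOf A := fun x hx => hCB hx
  haveI : Fintype (A ⧸ C.subgroupOf A) := Fintype.ofFinite _
  haveI : Fintype (A ⧸ B.subgroupOf A) := Fintype.ofFinite _
  haveI : Fintype (B ⧸ C.subgroupOf B) := Fintype.ofFinite _
  haveI : Fintype (B.subgroupOf A ⧸ (C.subgroupOf A).subgroupOf (B.subgroupOf A)) :=
    Fintype.ofFinite _
  set e := Subgroup.quotientEquivProdOfLE hst with he
  -- (1) the inner sum over `t ⧸ s.subgroupOf t` is `Tr_{L₃/L₂} P`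
  have hinner : localPairTraceOfEmb ι W H₂ H₃ P =
      ∑ r : B.subgroupOf A ⧸ (C.subgroupOf A).subgroupOf (B.subgroupOf A),
        (((r.out : B.subgroupOf A) : A) : Field.absoluteGaloisGroup E) • P := by
    let g : (B.subgroupOf A ⧸ (C.subgroupOf A).subgroupOf (B.subgroupOf A)) → B :=
      fun r => ⟨((r.out : B.subgroupOf A) : A), (r.out : B.subgroupOf A).2⟩
    have hg : Function.Bijective fun r => (QuotientGroup.mk (g r) : B ⧸ C.subgroupOf B) := by
      constructor
      · intro r r' h
        rw [QuotientGroup.eq] at h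
        rw [← QuotientGroup.out_eq' r, ← QuotientGroup.out_eq' r', QuotientGroup.eq]
        simpa [Subgroup.mem_subgroupOf, g] using h
      · intro q
        induction q using QuotientGroup.induction_on with
        | H b =>
          refine ⟨QuotientGroup.mk ⟨⟨(b : Field.absoluteGaloisGroup E), hBA b.2⟩, b.2⟩, ?_⟩
          rw [QuotientGroup.eq]
          obtain ⟨c, hc⟩ := QuotientGroup.mk_out_eq_mul
            ((C.subgroupOf A).subgroupOf (B.subgroupOf A))
            (⟨⟨(b : Field.absoluteGaloisGroup E), hBA b.2⟩, b.2⟩ : B.subgroupOf A)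
          have hc' : (((c : B.subgroupOf A) : A) : Field.absoluteGaloisGroup E) ∈ C := by
            have h2 := c.2
            rw [Subgroup.mem_subgroupOf, Subgroup.mem_subgroupOf] at h2
            exact h2
          simp only [Subgroup.mem_subgroupOf, g, hc, Subgroup.coe_mul, Subgroup.coe_inv]
          change ((b : Field.absoluteGaloisGroup E) *
            (((c : B.subgroupOf A) : A) : Field.absoluteGaloisGroup E))⁻¹ *
              (b : Field.absoluteGaloisGroup E) ∈ C
          rw [mul_inv_rev, mul_assoc, inv_mul_cancel, mul_one]
          exact C.inv_mem hc'
    rw [localPairTraceOfEmb_eq_sum_of_bijective ι W H₂ H₃ hP g hg]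
  -- (2) split the sum over `A ⧸ s` along `e`
  have hsplit : localPairTraceOfEmb ι W H₁ H₃ P =
      ∑ q : A ⧸ B.subgroupOf A, ((q.out : A) : Field.absoluteGaloisGroup E) •
        ∑ r : B.subgroupOf A ⧸ (C.subgroupOf A).subgroupOf (B.subgroupOf A),
          (((r.out : B.subgroupOf A) : A) : Field.absoluteGaloisGroup E) • P := by
    rw [localPairTraceOfEmb_apply]
    rw [← e.symm.sum_comp (fun x : A ⧸ C.subgroupOf A =>
        ((x.out : A) : Field.absoluteGaloisGroup E) • P), Fintype.sum_prod_type]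
    refine Finset.sum_congr rfl fun q _ => ?_
    rw [Finset.smul_sum]
    refine Finset.sum_congr rfl fun r _ => ?_
    induction r using QuotientGroup.induction_on with
    | H b =>
      have hx : e.symm (q, (QuotientGroup.mk b)) =
          QuotientGroup.mk (s := C.subgroupOf A) (q.out * (b : A)) := by
        rw [he, Subgroup.quotientEquivProdOfLE_symm_apply]
        rfl
      show (((e.symm (q, (QuotientGroup.mk b))).out : A) : Field.absoluteGaloisGroup E) • P =
        ((q.out : A) : Field.absoluteGaloisGroup E) •
          ((((QuotientGroup.mk (s := (C.subgroupOf A).subgroupOf (B.subgroupOf A)) b).out :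
            B.subgroupOf A) : A) : Field.absoluteGaloisGroup E) • P
      rw [hx, out_smul_eq_of_mem_localFixedPointsOfEmb ι W hP (q.out * (b : A)), Subgroup.coe_mul,
        mul_smul]
      congr 1
      obtain ⟨c, hc⟩ := QuotientGroup.mk_out_eq_mul
        ((C.subgroupOf A).subgroupOf (B.subgroupOf A)) b
      have hcC : (((c : B.subgroupOf A) : A) : Field.absoluteGaloisGroup E) ∈ C := by
        have h2 := c.2
        rw [Subgroup.mem_subgroupOf, Subgroup.mem_subgroupOf] at h2
        exact h2
      rw [hc]
      show _ = ((((b : B.subgroupOf A) : A) : Field.absoluteGaloisGroup E) *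
        (((c : B.subgroupOf A) : A) : Field.absoluteGaloisGroup E)) • P
      rw [mul_smul, (mem_localFixedPointsOfEmb_iff ι W H₃ P).mp hP _ hcC]
  rw [hsplit, ← hinner, localPairTraceOfEmb_apply ι W H₁ H₂]

/-- **Galois equivariance of the trace** for NORMAL `H₁, H₂`: `g • Tr_{L₂/L₁} P = Tr_{L₂/L₁} (g • P)`
for every `g ∈ Γ_E` and `P ∈ E(L₂,w)` — conjugation by `g` permutes the cosets of `(H₂)_E` in
`(H₁)_E`. [cite: Kobayashi2003, §2 p. 4] [cite: SerreGaloisCohomology1997, II.§1.1] -/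
theorem smul_localPairTraceOfEmb_of_normal (H₁ H₂ : Subgroup (Field.absoluteGaloisGroup K))
    [H₁.Normal] [H₂.Normal] [H₂.FiniteIndex] (g : Field.absoluteGaloisGroup E)
    {P : localPoints W E} (hP : P ∈ localFixedPointsOfEmb ι W H₂) :
    g • localPairTraceOfEmb ι W H₁ H₂ P = localPairTraceOfEmb ι W H₁ H₂ (g • P) := by
  set A := localSubgroupOfEmb H₁ ι with hA
  set B := localSubgroupOfEmb H₂ ι with hB
  have hAn : A.Normal := normal_localSubgroupOfEmb ι H₁
  have hBn : B.Normal := normal_localSubgroupOfEmb ι H₂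
  haveI : Fintype (A ⧸ B.subgroupOf A) := Fintype.ofFinite _
  have hgP : g • P ∈ localFixedPointsOfEmb ι W H₂ := smul_mem_localFixedPointsOfEmb ι W H₂ g hP
  -- conjugated representatives `g q̃ g⁻¹`
  let c : (A ⧸ B.subgroupOf A) → A := fun q =>
    ⟨g * (q.out : Field.absoluteGaloisGroup E) * g⁻¹, hAn.conj_mem _ (q.out).2 g⟩
  have hc : Function.Bijective fun q => (QuotientGroup.mk (c q) : A ⧸ B.subgroupOf A) := by
    rw [← Finite.injective_iff_bijective]
    intro q q' h
    rw [QuotientGroup.eq] at h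
    rw [← QuotientGroup.out_eq' q, ← QuotientGroup.out_eq' q', QuotientGroup.eq,
      Subgroup.mem_subgroupOf]
    simp only [Subgroup.mem_subgroupOf, c, Subgroup.coe_mul, Subgroup.coe_inv, mul_inv_rev,
      inv_inv] at h
    have h' : g * (((q.out : A) : Field.absoluteGaloisGroup E)⁻¹ *
        ((q'.out : A) : Field.absoluteGaloisGroup E)) * g⁻¹ ∈ B := by
      have : g * (q.out : Field.absoluteGaloisGroup E)⁻¹ * g⁻¹ *
          (g * (q'.out : Field.absoluteGaloisGroup E) * g⁻¹) =
          g * (((q.out : A) : Field.absoluteGaloisGroup E)⁻¹ *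
            ((q'.out : A) : Field.absoluteGaloisGroup E)) * g⁻¹ := by group
      rw [← this]; exact h
    have := hBn.conj_mem _ h' g⁻¹
    simpa [mul_assoc] using this
  rw [localPairTraceOfEmb_eq_sum_of_bijective ι W H₁ H₂ hgP c hc, localPairTraceOfEmb_apply,
    Finset.smul_sum]
  refine Finset.sum_congr rfl fun q _ => ?_
  simp only [c, mul_smul, inv_smul_smul]

end Trans

/-! ## §2 Antitone normal towers: monotonicity, Galois stability of `E^ε`, the trivial bound -/

/-- `(−1)^m = (−1)^n ↔ m ≡ n (mod 2)` for naturals, in the form used below. [folklore] -/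
theorem negOnePow_natCast_eq_iff (m n : ℕ) :
    (m : ℤ).negOnePow = (n : ℤ).negOnePow ↔ (Even m ↔ Even n) := by
  rcases Int.even_or_odd (m : ℤ) with hm | hm <;> rcases Int.even_or_odd (n : ℤ) with hn | hn
  · rw [Int.negOnePow_even _ hm, Int.negOnePow_even _ hn]
    simp only [true_iff]
    exact ⟨fun _ => (Int.even_coe_nat n).mp hn, fun _ => (Int.even_coe_nat m).mp hm⟩
  · rw [Int.negOnePow_even _ hm, Int.negOnePow_odd _ hn]
    simp only [show (1 : ℤˣ) ≠ -1 by decide, false_iff, not_iff]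
    have hm' := (Int.even_coe_nat m).mp hm
    have hn' : ¬ Even n := fun h => (Int.not_even_iff_odd.mpr hn) ((Int.even_coe_nat n).mpr h)
    tauto
  · rw [Int.negOnePow_odd _ hm, Int.negOnePow_even _ hn]
    simp only [show (-1 : ℤˣ) ≠ 1 by decide, false_iff, not_iff]
    have hn' := (Int.even_coe_nat n).mp hn
    have hm' : ¬ Even m := fun h => (Int.not_even_iff_odd.mpr hm) ((Int.even_coe_nat m).mpr h)
    tauto
  · rw [Int.negOnePow_odd _ hm, Int.negOnePow_odd _ hn]
    simp only [true_iff]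
    have hm' : ¬ Even m := fun h => (Int.not_even_iff_odd.mpr hm) ((Int.even_coe_nat m).mpr h)
    have hn' : ¬ Even n := fun h => (Int.not_even_iff_odd.mpr hn) ((Int.even_coe_nat n).mpr h)
    tauto

section Tower

variable {K : Type u} [Field K] {E : Type u} [Field E] [Algebra K E]
  (U : ℕ → Subgroup (Field.absoluteGaloisGroup K)) [hU : ∀ n, (U n).FiniteIndex]
  (ι : AlgebraicClosure K →ₐ[K] AlgebraicClosure E) (W : WeierstrassCurve K)

/-- Traces of a LOWER point: for `P ∈ E(K_{k,v})` and `m ≤ k ≤ n`,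
`Tr_{n/m} P = [K_{n,v} : K_{k,v}] · Tr_{k/m} P`. [cite: Kobayashi2003, §2 p. 4] -/
theorem localPairTraceOfEmb_of_mem_mid (hUa : Antitone U) {m k n : ℕ} (hmk : m ≤ k) (hkn : k ≤ n)
    {P : localPoints W E} (hP : P ∈ localFixedPointsOfEmb ι W (U k)) :
    localPairTraceOfEmb ι W (U m) (U n) P =
      ((localSubgroupOfEmb (U n) ι).subgroupOf (localSubgroupOfEmb (U k) ι)).index •
        localPairTraceOfEmb ι W (U m) (U k) P := by
  rw [localPairTraceOfEmb_trans ι W (hUa hmk) (hUa hkn)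
      (localFixedPointsOfEmb_antitone ι W (hUa hkn) hP),
    localPairTraceOfEmb_apply_of_mem_lower ι W hP, map_nsmul]

/-- **`E^ε(K_{m,v}) ≤ E^ε(K_{n,v})` for `m ≤ n`** (antitone tower of normal finite-index subgroups):
for `P ∈ E^ε(K_{m,v})` and a signed `m' < n`, either `m' ≥ m` and
`Tr_{n/m'+1} P = [K_{n,v} : K_{m'+1,v}]·P ∈ E(K_{m,v}) ≤ E(K_{m',v})`, or `m' < m` and
`Tr_{n/m'+1} P = [K_{n,v} : K_{m,v}] · Tr_{m/m'+1} P ∈ E(K_{m',v})`; likewise for the `m = −1`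
clause. ("`C_ss(m_{n−2}) ⊆ C_ss(m_n)`", proof of Prop. 8.12.) [cite: Kobayashi2003, Prop. 8.12 (proof, p. 18), §2 p. 4] -/
theorem towerSignedLocalPointsOfEmb_mono (hUa : Antitone U) (ε : ℤˣ) {m n : ℕ} (hmn : m ≤ n) :
    towerSignedLocalPointsOfEmb U ι W ε m ≤ towerSignedLocalPointsOfEmb U ι W ε n := by
  intro P hP
  rw [mem_towerSignedLocalPointsOfEmb_iff] at hP ⊢
  obtain ⟨hPm, hsgn, hneg⟩ := hP
  refine ⟨localFixedPointsOfEmb_antitone ι W (hUa hmn) hPm, fun m' hm' hε => ?_, fun hε => ?_⟩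
  · rcases le_or_gt m m' with h | h
    · -- `P ∈ E(K_{m,v}) ≤ E(K_{m'+1,v})`: the trace is a multiple of `P`
      rw [localPairTraceOfEmb_apply_of_mem_lower ι W
        (localFixedPointsOfEmb_antitone ι W (hUa (Nat.le_succ_of_le h)) hPm)]
      exact AddSubgroup.nsmul_mem _ (localFixedPointsOfEmb_antitone ι W (hUa h) hPm) _
    · rw [localPairTraceOfEmb_of_mem_mid U ι W hUa (Nat.succ_le_of_lt h) hmn hPm]
      exact AddSubgroup.nsmul_mem _ (hsgn m' h hε) _
  · rcases Nat.eq_zero_or_pos m with rfl | hm0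
    · rw [localPairTraceOfEmb_apply_of_mem_lower ι W hPm]
      have h0 := hneg hε
      rw [localPairTraceOfEmb_self_of_mem ι W (U 0) hPm] at h0
      exact AddSubgroup.nsmul_mem _ h0 _
    · rw [localPairTraceOfEmb_of_mem_mid U ι W hUa (Nat.zero_le m) hmn hPm]
      exact AddSubgroup.nsmul_mem _ (hneg hε) _

/-- **`E^ε(K_{n,v})` is `Γ_E`-stable** (normal tower): `g • Tr_{n/m+1} P = Tr_{n/m+1} (g • P)` and
the `E(K_{m,v})` are `Γ_E`-stable. So the Galois conjugates `c_n^σ` of a point of `E^ε(K_{n,v})` lie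
in `E^ε(K_{n,v})` ("`(c_n^σ)_{σ ∈ G_n}`", Prop. 8.11 / 8.12 i)). [cite: Kobayashi2003, Prop. 8.12 i) (p. 17), §2 p. 4] -/
theorem smul_mem_towerSignedLocalPointsOfEmb [hN : ∀ n, (U n).Normal] (ε : ℤˣ) (n : ℕ)
    (g : Field.absoluteGaloisGroup E) {P : localPoints W E}
    (hP : P ∈ towerSignedLocalPointsOfEmb U ι W ε n) :
    g • P ∈ towerSignedLocalPointsOfEmb U ι W ε n := by
  rw [mem_towerSignedLocalPointsOfEmb_iff] at hP ⊢
  obtain ⟨hPn, hsgn, hneg⟩ := hP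
  refine ⟨smul_mem_localFixedPointsOfEmb ι W (U n) g hPn, fun m hm hε => ?_, fun hε => ?_⟩
  · rw [← smul_localPairTraceOfEmb_of_normal ι W (U (m + 1)) (U n) g hPn]
    exact smul_mem_localFixedPointsOfEmb ι W (U m) g (hsgn m hm hε)
  · rw [← smul_localPairTraceOfEmb_of_normal ι W (U 0) (U n) g hPn]
    exact smul_mem_localFixedPointsOfEmb ι W ⊤ g (hneg hε)

/-- A point of `E(K_{n+1,v})` whose trace `Tr_{n+1/n}` (hence ALL of whose traces `Tr_{n+1/j}`,
`j ≤ n`) vanishes lies in `E^{(−1)^{n+1}}(K_{n+1,v})` — the sign whose conditions are the layers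
`m ≡ n + 1 (mod 2)`, `m < n + 1`, i.e. `m ≤ n − 1` (the OTHER sign would ask `Tr_{n+1/n+1} P = P ∈
E(K_{n,v})`). [cite: Kobayashi2003, §2 p. 4] -/
theorem mem_towerSignedLocalPointsOfEmb_of_trace_eq_zero (hUa : Antitone U) (n : ℕ)
    {P : localPoints W E} (hP : P ∈ localFixedPointsOfEmb ι W (U (n + 1)))
    (h0 : localPairTraceOfEmb ι W (U n) (U (n + 1)) P = 0) :
    P ∈ towerSignedLocalPointsOfEmb U ι W (((n + 1 : ℕ) : ℤ).negOnePow) (n + 1) := by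
  -- every trace to a layer `≤ n` factors through `Tr_{n+1/n} P = 0`
  have hzero : ∀ m ≤ n, localPairTraceOfEmb ι W (U m) (U (n + 1)) P = 0 := by
    intro m hm
    rw [localPairTraceOfEmb_trans ι W (hUa hm) (hUa (Nat.le_succ n)) hP, h0, map_zero]
  rw [mem_towerSignedLocalPointsOfEmb_iff]
  refine ⟨hP, fun m hm hε => ?_, fun _ => ?_⟩
  · -- `m ≡ n + 1 (mod 2)` and `m < n + 1` force `m + 1 ≤ n`
    have hmn : m + 1 ≤ n := by
      rw [negOnePow_natCast_eq_iff] at hε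
      rcases Nat.lt_or_ge m n with h | h
      · omega
      · exfalso
        have hm : m = n := by omega
        subst hm
        rcases Nat.even_or_odd m with h' | h'
        · exact Nat.not_even_iff_odd.mpr (Even.add_one h') (hε.mp h')
        · exact Nat.not_even_iff_odd.mpr h' (hε.mpr (Odd.add_one h'))
    rw [hzero (m + 1) hmn]; exact zero_mem _
  · rw [hzero 0 (Nat.zero_le n)]; exact zero_mem _

/-- **The trivial bound**: for `P ∈ E(K_{n+1,v})`, with `d = [K_{n+1,v} : K_{n,v}]`,
`d·P − Tr_{n+1/n} P` has all traces to lower layers zero (`Tr_{n+1/n}(d·P − Tr P) = d·Tr P − d·Tr P`),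
hence lies in `E^{(−1)^{n+1}}(K_{n+1,v})`, and **`d·P ∈ E^{(−1)^{n+1}}(K_{n+1,v}) ⊔ E(K_{n,v})`**. In
Kobayashi's tower `d = p`: `p·E(K_{n+1,v}) ⊆ E^{(−1)^{n+1}}(K_{n+1,v}) + E(K_{n,v})` — generation holds
trivially UP TO the index; the content of Prop. 8.12 ii) is the removal of this `p`.
[cite: Kobayashi2003, Prop. 8.12 ii) (pp. 17–18)] -/
theorem index_smul_mem_sup (hUa : Antitone U) (n : ℕ) {P : localPoints W E}
    (hP : P ∈ localFixedPointsOfEmb ι W (U (n + 1))) :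
    ((localSubgroupOfEmb (U (n + 1)) ι).subgroupOf (localSubgroupOfEmb (U n) ι)).index • P ∈
      towerSignedLocalPointsOfEmb U ι W (((n + 1 : ℕ) : ℤ).negOnePow) (n + 1) ⊔
        localFixedPointsOfEmb ι W (U n) := by
  set d := ((localSubgroupOfEmb (U (n + 1)) ι).subgroupOf (localSubgroupOfEmb (U n) ι)).index
  set T := localPairTraceOfEmb ι W (U n) (U (n + 1)) P with hT
  have hTn : T ∈ localFixedPointsOfEmb ι W (U n) := localPairTraceOfEmb_mem_of_mem ι W hP
  have hmem : d • P - T ∈ towerSignedLocalPointsOfEmb U ι W (((n + 1 : ℕ) : ℤ).negOnePow) (n + 1) := by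
    refine mem_towerSignedLocalPointsOfEmb_of_trace_eq_zero U ι W hUa n
      (sub_mem (AddSubgroup.nsmul_mem _ hP _)
        (localFixedPointsOfEmb_antitone ι W (hUa (Nat.le_succ n)) hTn)) ?_
    rw [map_sub, map_nsmul, ← hT, localPairTraceOfEmb_apply_of_mem_lower ι W hTn, sub_self]
  have : d • P = (d • P - T) + T := by abel
  rw [this]
  exact AddSubgroup.add_mem_sup hmem hTn

end Tower

end Summit.BirchSwinnertonDyer.Rank1Residual.Additive

end
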